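import Mathlib
import HarnessLib
import Literature.MathematicalPhysics.QuantumLattice.HubbardCommutatorBound
import Literature.MathematicalPhysics.QuantumLattice.DWaveSourceProofs

/-!
# Route `WeakCouplingBCS` — crux `WcbcsBcsConstruction` (stmt-HubbardSuperconductivity-2010),
# line `lro-seed-kink-bridge`, stub `stub_hamiltonianNormBound`

The volume-linear operator-norm bound of the grand-canonical Hubbard Hamiltonian
`H = hubbardTorusWith 2 L 1 U μ = H(1,U) - μN` on the torus `(ℤ/Lℤ)²`:
`‖H‖ ≤ B₁ (1 + U + |μ|) L²` for `U ≥ 0` (we take `B₁ = 10`).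

Proof (folklore): `H = Σ_Z h_Z` over the local terms `hubbardTermOp` indexed by ordered bonds and
sites (`sum_hubbardTermOp`), `‖h_Z‖ ≤ 2|t| + |U| + 2|μ|` (`norm_hubbardTermOp_le`), and the torus
`(ℤ/Lℤ)²` has degree `≤ 4` (`SourceGas.card_filter_fermionTorusGraph_adj_le`), hence at most
`4L² + L² = 5L²` local terms; so `‖H‖ ≤ 5L² (2 + U + 2|μ|) ≤ 10 (1 + U + |μ|) L²`.
-/

namespace Summit.HubbardSuperconductivity.HubbardSuperconductivity.Theorems

open Literature.MathematicalPhysics.QuantumLattice Literature.Probability.LatticeModels Matrix Filter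
open scoped Matrix.Norms.L2Operator ComplexOrder Topology

/-- **Counting the local terms of the Hubbard Hamiltonian**: on a finite graph of maximal degree
`≤ Δ`, the index set of local terms (ordered bonds and sites) has at most `(Δ + 1)|Λ|` elements.
[folklore] -/
theorem card_hubbardIdx_le_of_degree_le {Λ : Type*} [LinearOrder Λ] [Fintype Λ]
    (G : SimpleGraph Λ) [DecidableRel G.Adj] {Δ : ℕ}
    (hΔ : ∀ x : Λ, (Finset.univ.filter fun y => G.Adj x y).card ≤ Δ) :
    Fintype.card (HubbardIdx G) ≤ (Δ + 1) * Fintype.card Λ := by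
  -- adapted from `card_hubbardIdx_le` (HubbardTorusChargeFluctuations.lean)
  classical
  rw [Fintype.card_sum, add_mul, one_mul]
  refine Nat.add_le_add_right ?_ _
  have h1 : Fintype.card {p : Λ × Λ // G.Adj p.1 p.2} =
      (Finset.univ.filter fun p : Λ × Λ => G.Adj p.1 p.2).card := Fintype.card_subtype _
  rw [h1]
  have h2 : (Finset.univ.filter fun p : Λ × Λ => G.Adj p.1 p.2) =
      Finset.univ.biUnion fun x : Λ =>
        (Finset.univ.filter fun y => G.Adj x y).image fun y => (x, y) := by
    ext ⟨x, y⟩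
    simp
  rw [h2]
  calc (Finset.univ.biUnion fun x : Λ =>
          (Finset.univ.filter fun y => G.Adj x y).image fun y => (x, y)).card
      ≤ ∑ x : Λ, ((Finset.univ.filter fun y => G.Adj x y).image fun y => (x, y)).card :=
        Finset.card_biUnion_le
    _ ≤ ∑ _x : Λ, Δ := Finset.sum_le_sum fun x _ => Finset.card_image_le.trans (hΔ x)
    _ = Δ * Fintype.card Λ := by rw [Finset.sum_const, Finset.card_univ, smul_eq_mul, mul_comm]

/-- The two-dimensional fermionic torus `(ℤ/Lℤ)²` carries at most `5L²` local Hubbard terms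
(degree `≤ 4`, `L²` sites). [folklore] -/
theorem card_hubbardIdx_fermionTorus_two_le (L : ℕ) [NeZero L] :
    Fintype.card (HubbardIdx (fermionTorusGraph 2 L)) ≤ 5 * L ^ 2 := by
  have h := card_hubbardIdx_le_of_degree_le (fermionTorusGraph 2 L) (Δ := 4)
    fun x => SourceGas.card_filter_fermionTorusGraph_adj_le x
  have hcard : Fintype.card (FermionTorus 2 L) = L ^ 2 := by
    change Fintype.card (Fin 2 → Fin L) = L ^ 2
    rw [Fintype.card_fun, Fintype.card_fin, Fintype.card_fin]
  rw [hcard] at h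
  exact h

/-- **Stub S1a** of the line `lro-seed-kink-bridge` (crux `WcbcsBcsConstruction`): the operator norm
of the grand-canonical torus Hubbard Hamiltonian is linear in the volume,
`‖H(1,U) - μN‖ ≤ B₁ (1 + U + |μ|) L²` for `U ≥ 0` (here `B₁ = 10`: at most `5L²` local terms, each
of norm `≤ 2 + U + 2|μ|`). [folklore] -/
theorem stub_hamiltonianNormBound :
    ∃ B₁ : ℝ, 0 < B₁ ∧ ∀ (L : ℕ) [NeZero L] (U μ : ℝ), 0 ≤ U →
      ‖hubbardTorusWith 2 L 1 U μ‖ ≤ B₁ * (1 + U + |μ|) * (L : ℝ) ^ 2 := by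
  refine ⟨10, by norm_num, fun L _ U μ hU => ?_⟩
  have hcard : (Fintype.card (HubbardIdx (fermionTorusGraph 2 L)) : ℝ) ≤ 5 * (L : ℝ) ^ 2 := by
    exact_mod_cast card_hubbardIdx_fermionTorus_two_le L
  have hterm : 2 * |(1 : ℝ)| + |U| + 2 * |μ| ≤ 2 * (1 + U + |μ|) := by
    rw [abs_one, abs_of_nonneg hU]
    linarith
  rw [hubbardTorusWith, ← sum_hubbardTermOp]
  calc ‖∑ Z, hubbardTermOp (fermionTorusGraph 2 L) 1 U μ Z‖
      ≤ ∑ Z, ‖hubbardTermOp (fermionTorusGraph 2 L) 1 U μ Z‖ := norm_sum_le _ _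
    _ ≤ ∑ _Z : HubbardIdx (fermionTorusGraph 2 L), 2 * (1 + U + |μ|) :=
        Finset.sum_le_sum fun Z _ => (norm_hubbardTermOp_le _ 1 U μ Z).trans hterm
    _ = (Fintype.card (HubbardIdx (fermionTorusGraph 2 L)) : ℝ) * (2 * (1 + U + |μ|)) := by
        rw [Finset.sum_const, nsmul_eq_mul, Finset.card_univ]
    _ ≤ (5 * (L : ℝ) ^ 2) * (2 * (1 + U + |μ|)) :=
        mul_le_mul_of_nonneg_right hcard (by positivity)
    _ = 10 * (1 + U + |μ|) * (L : ℝ) ^ 2 := by ring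

end Summit.HubbardSuperconductivity.HubbardSuperconductivity.Theorems
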